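import Mathlib
import Summits.NavierStokesRegularity.FluidComputer.AbcClassIIX0
import Summits.NavierStokesRegularity.FluidComputer.AbcClassIISections
import Summits.NavierStokesRegularity.FluidComputer.SkewCutGalerkinMinimalTranscripts

/-!
# Class-II layer of the skew-cut X0 chain, (A3): the OPEN bracket from the minimal transcript
(instab3 g6 — implementation 1, written against implementation 2's class-II files; cell `ns-blowup`,
2026-08-27)

HONEST FRAMING (human rulings D-0035/D-0074): nothing here is a claim about Navier–Stokes blow-up.
WHAT THIS IS NOT: not NS evidence. MODEL lane (the NS operator linearised about the forced ABC 1:1:1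
flow); no certificate, printed number or census word is moved. instab4 g6's
`AbcClassIISections.isLinNSEigenvalue_of_certificate` turns the three transcript-shaped facts of an X0
certificate — head determinant signs (T1), shell forms with the true head inverse (T2), tail numbers
(T3), stated about the kernel's class-II section matrices `[(x + |O|²/R)δ − amat]` — into a classical
eigenvalue `λ ∈ [x₁, x₂]` (CLOSED bracket). This file gives the OPEN bracket `λ ∈ (x₁, x₂)` from the
same three facts (the shell forms stated on head-vanishing coefficient vectors), by instantiating the
generic `SkewCutGalerkinMinimalTranscripts.exists_smooth_eigenvector_Ioo_of_minimal_transcripts`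
(instab3 g6) on implementation 2's index set `Idx` / matrix `amat` / cubes `cubeIdx`, with the structural
data exactly as in `AbcClassIIX0.isLinNSEigenvalue_of_section_eigenpairs` and the synthesis of
`AbcClassIISynthesis`:

* `section_pairing_amat` — the section pairing hypothesis `Re Σ_{G×G} conj(u_i) amat_ij u_j ≤ √2 Σ_G |u_i|²`
  for EVERY finite `G` (from `AbcClassIISectionsPrep.abs_re_pairing_form_le` by zero-padding);
* `isLinNSEigenvalue_Ioo_of_minimal_transcripts` — (T1) + (T2′) + (T3) ⇒ `∃ λ ∈ (x₁, x₂)`,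
  `Torus.IsLinNSEigenvalue (1/(2πR)) (Torus.abcFlow 1 1 1) (2πλ)`.
The sequel `AbcClassIIOpenBracketCertificate` restates this with implementation 2's shell hypotheses
VERBATIM (shape conversion) and adds rung R-α (Lyapunov instability, conditional on FPS06).

Mathlib + the files named; no new definitions.
-/

noncomputable section

open scoped BigOperators ComplexConjugate InnerProductSpace Matrix
open Finset MeasureTheory UnitAddTorus Filter Topology Matrix

namespace Summit.NavierStokesRegularity.FluidComputer.AbcClassIIOpenBracket

open Literature.Analysis.FunctionSpaces Literature.Analysis.FunctionSpaces.Torus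
open Literature.Analysis.FunctionSpaces.EuclideanSpace
open Literature.Analysis.FluidPDE Literature.Analysis.FluidPDE.SteadyLattice
open Literature.Analysis.FluidPDE.ScalarFourier
open Summit.NavierStokesRegularity.FluidComputer.AbcClassII

/-- **The section pairing hypothesis for `amat` on every finite index set** (`s = √2`). -/
theorem section_pairing_amat (G : Finset Idx) (u : Idx → ℂ) :
    RCLike.re (∑ i ∈ G, ∑ j ∈ G, conj (u i) * ((amat i j : ℝ) : ℂ) * u j) ≤
      Real.sqrt 2 * ∑ i ∈ G, ‖u i‖ ^ 2 := by
  classical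
  -- a cube containing `G`
  set n : ℕ := G.sup fun i => osupNorm i.1 with hn
  have hG : G ⊆ cubeIdx n := fun i hi => mem_cubeIdx.mpr (Finset.le_sup (f := fun i => osupNorm i.1) hi)
  -- zero-padding
  set v : Idx → ℂ := fun i => if i ∈ G then u i else 0 with hv
  have hvG : ∀ i ∉ G, v i = 0 := fun i hi => by simp only [hv, if_neg hi]
  have hvG' : ∀ i ∈ G, v i = u i := fun i hi => by simp only [hv, if_pos hi]
  have key := abs_re_pairing_form_le n v
  have hin : ∀ i, ∑ j ∈ cubeIdx n, ((amat i j : ℝ) : ℂ) * v j = ∑ j ∈ G, ((amat i j : ℝ) : ℂ) * u j := by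
    intro i
    rw [← Finset.sum_subset hG fun j _ hj => by rw [hvG j hj, mul_zero]]
    exact Finset.sum_congr rfl fun j hj => by rw [hvG' j hj]
  have hout : ∑ i ∈ cubeIdx n, (starRingEnd ℂ) (v i) * ∑ j ∈ cubeIdx n, ((amat i j : ℝ) : ℂ) * v j =
      ∑ i ∈ G, ∑ j ∈ G, conj (u i) * ((amat i j : ℝ) : ℂ) * u j := by
    rw [← Finset.sum_subset hG fun i _ hi => by rw [hvG i hi, map_zero, zero_mul]]
    refine Finset.sum_congr rfl fun i hi => ?_
    rw [hvG' i hi, hin i, Finset.mul_sum]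
    exact Finset.sum_congr rfl fun j _ => by ring
  have hnorm : ∑ j ∈ cubeIdx n, ‖v j‖ ^ 2 = ∑ i ∈ G, ‖u i‖ ^ 2 := by
    rw [← Finset.sum_subset hG fun j _ hj => by rw [hvG j hj, norm_zero]; ring]
    exact Finset.sum_congr rfl fun j hj => by rw [hvG' j hj]
  rw [hout, hnorm] at key
  rw [RCLike.re_to_complex]
  exact (le_abs_self _).trans key

/-- The head matrix in the generic chain's form equals implementation 2's section matrix on the head
cube (`(a : Idx) = b ↔ a = b` on the subtype, `x − (−|O|²/R) = x + |O|²/R`). -/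
theorem headMatrix_eq (R x : ℝ) (K : ℕ) :
    (Matrix.of fun a b : ↥(cubeIdx K) => (if a = b then x - (-(onormSq (b : Idx).1 / R)) else 0) - amat a b) =
      Matrix.of fun a b : ↥(cubeIdx K) =>
        (if (a : Idx) = b then x + onormSq (b : Idx).1 / R else 0) - amat a b := by
  ext a b
  simp only [Matrix.of_apply, sub_neg_eq_add, Subtype.coe_inj]

/-- **(A3) THE OPEN BRACKET for class II from the minimal transcript.** For `R ≥ 1`, a head cube
`K`, a bracket `x₁ < x₂`: HEAD SIGNS (T1) `det A(x₁)·det A(x₂) < 0` for the class-II head matrices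
`A(x) = [(x + |O|²/R)δ − amat]` on `cubeIdx K`; SHELL TESTS (T2′) with the true inverse `A(x_e)⁻¹`,
stated on real coefficient vectors vanishing on the head (`MU2_e Σ_{shell} x_i² ≤ Σ_{shell}(x_e + |O_i|²/R
− √2) x_i² − xᵀ(C A(x_e)⁻¹ B)x`, the (V5) test `λ_min(Λ_{K+1} − √2 + Q_K) ≥ MU2_e > 0`); TAIL NUMBERS
(T3) `MU2_e ≤ x_e + (K+2)²/R − √2` ⇒ `∃ λ ∈ (x₁, x₂)` (OPEN), `Torus.IsLinNSEigenvalue (1/(2πR))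
(Torus.abcFlow 1 1 1) (2πλ)`. MODEL statement; not NS; the truth of (T1)(T2′)(T3) for the kernel's
matrices is the certifiers' verified arithmetic (CERTIFIER AUDIT). -/
theorem isLinNSEigenvalue_Ioo_of_minimal_transcripts {R : ℝ} (hR : 1 ≤ R) (K : ℕ) {x₁ x₂ : ℝ}
    (hlt : x₁ < x₂) (μ₁ μ₂ : ℝ) (hμ₁ : 0 < μ₁) (hμ₂ : 0 < μ₂)
    (hq₁ : μ₁ ≤ x₁ + ((K : ℝ) + 2) ^ 2 / R - Real.sqrt 2)
    (hq₂ : μ₂ ≤ x₂ + ((K : ℝ) + 2) ^ 2 / R - Real.sqrt 2)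
    (hdet : (Matrix.of fun a b : ↥(cubeIdx K) =>
        (if (a : Idx) = b then x₁ + onormSq (b : Idx).1 / R else 0) - amat a b).det *
      (Matrix.of fun a b : ↥(cubeIdx K) =>
        (if (a : Idx) = b then x₂ + onormSq (b : Idx).1 / R else 0) - amat a b).det < 0)
    (hshell₁ : ∀ x : Idx → ℝ, (∀ i ∈ cubeIdx K, x i = 0) →
      μ₁ * ∑ i ∈ cubeIdx (K + 1) \ cubeIdx K, x i ^ 2 ≤
        ∑ i ∈ cubeIdx (K + 1) \ cubeIdx K, (x₁ + onormSq i.1 / R - Real.sqrt 2) * x i ^ 2 -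
        ∑ i ∈ (cubeIdx K).biUnion nbrIdx \ cubeIdx K, (∑ j : ↥(cubeIdx K), amat i j *
          ∑ m : ↥(cubeIdx K), (Matrix.of fun a b : ↥(cubeIdx K) =>
            (if (a : Idx) = b then x₁ + onormSq (b : Idx).1 / R else 0) - amat a b)⁻¹ j m *
            ∑ l ∈ nbrIdx m \ cubeIdx K, amat m l * x l) * x i)
    (hshell₂ : ∀ x : Idx → ℝ, (∀ i ∈ cubeIdx K, x i = 0) →
      μ₂ * ∑ i ∈ cubeIdx (K + 1) \ cubeIdx K, x i ^ 2 ≤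
        ∑ i ∈ cubeIdx (K + 1) \ cubeIdx K, (x₂ + onormSq i.1 / R - Real.sqrt 2) * x i ^ 2 -
        ∑ i ∈ (cubeIdx K).biUnion nbrIdx \ cubeIdx K, (∑ j : ↥(cubeIdx K), amat i j *
          ∑ m : ↥(cubeIdx K), (Matrix.of fun a b : ↥(cubeIdx K) =>
            (if (a : Idx) = b then x₂ + onormSq (b : Idx).1 / R else 0) - amat a b)⁻¹ j m *
            ∑ l ∈ nbrIdx m \ cubeIdx K, amat m l * x l) * x i) :
    ∃ lam ∈ Set.Ioo x₁ x₂,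
      Torus.IsLinNSEigenvalue (1 / (2 * Real.pi * R)) (Torus.abcFlow 1 1 1) ((2 * Real.pi * lam : ℝ) : ℂ) := by
  classical
  have hR0 : 0 < R := by linarith
  -- the Hilbert space ℓ²(Idx) with its canonical basis
  let b : HilbertBasis Idx ℂ (lp (fun _ : Idx => ℂ) 2) := ⟨LinearIsometryEquiv.refl ℂ _⟩
  have hb : ∀ (z : lp (fun _ : Idx => ℂ) 2) (i : Idx), ⟪b i, z⟫_ℂ = z i := fun z i => by
    rw [← b.repr_apply_apply]; rfl
  -- levels
  set ℓ : Idx → ℝ := fun i => -(onormSq i.1 / R) with hℓ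
  have hℓ0 : ∀ i, ℓ i ≤ 0 := fun i => neg_nonpos.mpr (div_nonneg (onormSq_nonneg _) hR0.le)
  have hℓt : Tendsto ℓ cofinite atBot := tendsto_levels hR0
  -- constants and the base point (`x₀ ≥ x₂` for the graph-bound monotonicity)
  set Kc : ℝ := 2592 * Real.sqrt R with hKc
  have hKc0 : 0 ≤ Kc := by positivity
  set P : ℝ := ((288 * 288 : ℕ) : ℝ) * Kc with hP
  have hP0 : 0 ≤ P := by positivity
  set x₀ : ℝ := P ^ 2 + 2 + |x₂| with hx₀
  have hx₀1 : 1 ≤ x₀ := by nlinarith [sq_nonneg P, abs_nonneg x₂]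
  have hx₀0 : 0 < x₀ := by linarith
  have hx₂x₀ : x₂ ≤ x₀ := by nlinarith [sq_nonneg P, le_abs_self x₂]
  -- the resolvent symbol and the weights
  obtain ⟨d, hdform, hd, hd0, hw0, hwℓ, -⟩ :=
    SkewCutGalerkinWeights.exists_resolventSymbol (𝕜 := ℂ) ℓ hℓ0 hℓt x₀ hx₀1
  have hwgt : ∀ i, Real.sqrt (1 + |ℓ i|) = Real.sqrt (1 + onormSq i.1 / R) := fun i => by
    simp only [hℓ]; rw [abs_neg, abs_of_nonneg (div_nonneg (onormSq_nonneg _) hR0.le)]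
  -- the matrix of the relative bound
  set t : Idx → Idx → ℂ := fun i j => ((amat i j : ℝ) : ℂ) * d j with ht
  have htx : ∀ i j, t i j * ((x₀ : ℂ) - (ℓ j : ℂ)) = ((amat i j : ℝ) : ℂ) := fun i j => by
    have h := hd j
    change ((amat i j : ℝ) : ℂ) * d j * ((x₀ : ℂ) - (ℓ j : ℂ)) = ((amat i j : ℝ) : ℂ)
    linear_combination ((amat i j : ℝ) : ℂ) * h
  have ht0 : ∀ i j, j ∉ nbrIdx i → t i j = 0 := fun i j hj => by
    change ((amat i j : ℝ) : ℂ) * d j = 0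
    rw [amat_eq_zero_of_not_mem hj]; simp
  -- first-order growth
  have hgrow : ∀ j : Idx, 2592 * Real.sqrt (1 + onormSq j.1) ≤ Kc * Real.sqrt (1 + onormSq j.1 / R) := by
    intro j
    rw [hKc, mul_assoc, ← Real.sqrt_mul hR0.le]
    refine mul_le_mul_of_nonneg_left (Real.sqrt_le_sqrt ?_) (by norm_num)
    rw [mul_add, mul_one, mul_div_cancel₀ _ hR0.ne']
    linarith [onormSq_nonneg j.1]
  have ha : ∀ i j, j ∈ nbrIdx i → ‖t i j * ((x₀ : ℂ) - (ℓ j : ℂ))‖ ≤ Kc * Real.sqrt (1 + |ℓ j|) := by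
    intro i j _
    rw [htx, Complex.norm_real, Real.norm_eq_abs, hwgt]
    exact (abs_amat_le i j).trans (hgrow j)
  -- comparable weights along the band
  have hL : ∀ i j, j ∈ nbrIdx i →
      Real.sqrt (1 + |ℓ i|) ≤ Real.sqrt (2 * (1 + R⁻¹)) * Real.sqrt (1 + |ℓ j|) := by
    intro i j hj
    rw [hwgt, hwgt, ← Real.sqrt_mul (by positivity)]
    exact Real.sqrt_le_sqrt (one_add_onormSq_le_of_mem_nbrIdx hR0 hj)
  -- the resolvent gains what the weight costs
  have hM : ∀ i, ‖d i‖ * Real.sqrt (1 + |ℓ i|) ≤ 1 / Real.sqrt x₀ := by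
    intro i
    have e : ‖d i‖ = (x₀ - ℓ i)⁻¹ := by
      rw [hdform i, RCLike.norm_ofReal, abs_of_nonneg (inv_nonneg.mpr (by linarith [hℓ0 i]))]
    rw [e]; exact SkewCutGalerkinLattice.weight_mul_symbol_le (hℓ0 i) hx₀1
  -- Schur data
  have hsymm : ∀ i j : Idx, j ∈ nbrIdx i ↔ i ∈ nbrIdx j := mem_nbrIdx_comm
  have hWcard : ∀ i : Idx, (nbrIdx i).card ≤ 288 * 288 := card_nbrIdx_le
  have hq : ((288 * 288 : ℕ) : ℝ) * Kc * (1 / Real.sqrt x₀) < 1 := by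
    rw [← hP, mul_one_div, div_lt_one (Real.sqrt_pos.mpr hx₀0), Real.lt_sqrt hP0, hx₀]
    linarith [abs_nonneg x₂]
  obtain ⟨hrow, hRle, hcol, hCle, hR00, hprod⟩ :=
    SkewCutGalerkinLattice.schur_data_of_band t ℓ x₀ (fun i => d i) hd nbrIdx hsymm hWcard ht0
      (fun i => Real.sqrt (1 + |ℓ i|)) hKc0 (by positivity) ha hM hq
  -- the section pairing bound in the chain's syntax
  have hA : ∀ (G : Finset Idx) (u : Idx → ℂ),
      RCLike.re (∑ i ∈ G, ∑ j ∈ G, conj (u i) * (t i j * ((x₀ : ℂ) - (ℓ j : ℂ))) * u j) ≤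
        Real.sqrt 2 * ∑ i ∈ G, ‖u i‖ ^ 2 := by
    intro G u; simp_rw [htx]; exact section_pairing_amat G u
  -- head cube, next cube, locality, sections
  have hHS : cubeIdx K ⊆ cubeIdx (K + 1) := cubeIdx_mono (Nat.le_succ K)
  have hloc : ∀ i ∈ cubeIdx K, nbrIdx i ⊆ cubeIdx (K + 1) := by
    intro i hi j hj
    have h1 := (osupNorm_le_of_mem_nbrIdx hj).2
    have h2 := mem_cubeIdx.mp hi
    exact mem_cubeIdx.mpr (by omega)
  set F : ℕ → Finset Idx := fun n => cubeIdx (K + 1 + n) with hFdef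
  have hF : Monotone F := fun m n h => cubeIdx_mono (Nat.add_le_add_left h _)
  have hFex : ∀ i, ∃ n, i ∈ F n := fun i => ⟨osupNorm i.1, mem_cubeIdx.mpr (by omega)⟩
  have hFS : ∀ n, cubeIdx (K + 1) ⊆ F n := fun n => cubeIdx_mono (Nat.le_add_right _ _)
  -- the transcript-shaped data in the chain's syntax
  have hreal : ∀ i j, t i j * ((x₀ : ℂ) - (ℓ j : ℂ)) = ((amat i j : ℝ) : ℂ) := htx
  have hA₁ := headMatrix_eq R x₁ K
  have hA₂ := headMatrix_eq R x₂ K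
  have hsign : (Matrix.of fun a b : ↥(cubeIdx K) => (if a = b then x₁ - ℓ b else 0) - amat a b).det *
      (Matrix.of fun a b : ↥(cubeIdx K) => (if a = b then x₂ - ℓ b else 0) - amat a b).det < 0 := by
    simp only [hℓ]; rw [hA₁, hA₂]; exact hdet
  have htail₁ : ∀ i ∉ cubeIdx (K + 1), μ₁ ≤ x₁ - ℓ i - Real.sqrt 2 := by
    intro i hi
    have hK : K + 2 ≤ osupNorm i.1 := by
      have := mt mem_cubeIdx.mpr hi; push Not at this; omega
    have h1 : ((K : ℝ) + 2) ^ 2 ≤ onormSq i.1 := by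
      refine le_trans ?_ (sq_osupNorm_le_onormSq i.1)
      have : (K : ℝ) + 2 ≤ ((osupNorm i.1 : ℕ) : ℝ) := by exact_mod_cast hK
      exact pow_le_pow_left₀ (by positivity) this 2
    have h2 : ((K : ℝ) + 2) ^ 2 / R ≤ onormSq i.1 / R := div_le_div_of_nonneg_right h1 hR0.le
    simp only [hℓ]; linarith
  have htail₂ : ∀ i ∉ cubeIdx (K + 1), μ₂ ≤ x₂ - ℓ i - Real.sqrt 2 := by
    intro i hi
    have hK : K + 2 ≤ osupNorm i.1 := by
      have := mt mem_cubeIdx.mpr hi; push Not at this; omega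
    have h1 : ((K : ℝ) + 2) ^ 2 ≤ onormSq i.1 := by
      refine le_trans ?_ (sq_osupNorm_le_onormSq i.1)
      have : (K : ℝ) + 2 ≤ ((osupNorm i.1 : ℕ) : ℝ) := by exact_mod_cast hK
      exact pow_le_pow_left₀ (by positivity) this 2
    have h2 : ((K : ℝ) + 2) ^ 2 / R ≤ onormSq i.1 / R := div_le_div_of_nonneg_right h1 hR0.le
    simp only [hℓ]; linarith
  have hshell₁' : ∀ x : Idx → ℝ, (∀ i ∈ cubeIdx K, x i = 0) →
      μ₁ * ∑ i ∈ cubeIdx (K + 1) \ cubeIdx K, x i ^ 2 ≤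
        ∑ i ∈ cubeIdx (K + 1) \ cubeIdx K, (x₁ - ℓ i - Real.sqrt 2) * x i ^ 2 -
        ∑ i ∈ (cubeIdx K).biUnion nbrIdx \ cubeIdx K, (∑ j : ↥(cubeIdx K), amat i j *
          ∑ m : ↥(cubeIdx K), (Matrix.of fun a b : ↥(cubeIdx K) =>
            (if a = b then x₁ - ℓ b else 0) - amat a b)⁻¹ j m *
            ∑ l ∈ nbrIdx m \ cubeIdx K, amat m l * x l) * x i := by
    simp only [hℓ]; rw [hA₁]; simp only [sub_neg_eq_add]; exact hshell₁
  have hshell₂' : ∀ x : Idx → ℝ, (∀ i ∈ cubeIdx K, x i = 0) →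
      μ₂ * ∑ i ∈ cubeIdx (K + 1) \ cubeIdx K, x i ^ 2 ≤
        ∑ i ∈ cubeIdx (K + 1) \ cubeIdx K, (x₂ - ℓ i - Real.sqrt 2) * x i ^ 2 -
        ∑ i ∈ (cubeIdx K).biUnion nbrIdx \ cubeIdx K, (∑ j : ↥(cubeIdx K), amat i j *
          ∑ m : ↥(cubeIdx K), (Matrix.of fun a b : ↥(cubeIdx K) =>
            (if a = b then x₂ - ℓ b else 0) - amat a b)⁻¹ j m *
            ∑ l ∈ nbrIdx m \ cubeIdx K, amat m l * x l) * x i := by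
    simp only [hℓ]; rw [hA₂]; simp only [sub_neg_eq_add]; exact hshell₂
  -- the generic chain: minimal transcript ⇒ open bracket
  obtain ⟨T, -, -, lam, hlam, w, hw1, hcoordw, hreg⟩ :=
    SkewCutGalerkinMinimalTranscripts.exists_smooth_eigenvector_Ioo_of_minimal_transcripts b ℓ hℓ0 x₀ d
      hd hd0 t hrow hRle hcol hCle hR00 hR00 hprod nbrIdx hsymm hWcard ht0 amat hreal
      (fun i => Real.sqrt (1 + |ℓ i|)) hw0 hwℓ hKc0 ha (by positivity) hL hM hA (cubeIdx K)
      (cubeIdx (K + 1)) hHS hloc F hF hFex hFS hlt hx₂x₀ hμ₁ hshell₁' htail₁ hμ₂ hshell₂' htail₂ hsign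
  -- synthesis, as in `AbcClassIIX0.isLinNSEigenvalue_of_section_eigenpairs`
  set wc : Idx → ℂ := fun i => ⟪b i, w⟫_ℂ with hwc
  have hcoord : ∀ i : Idx, ((-(onormSq i.1 / R) : ℝ) : ℂ) * wc i +
      ∑ j ∈ nbrIdx i, ((amat i j : ℝ) : ℂ) * wc j = (lam : ℂ) * wc i := by
    intro i
    have hs : ∑ j ∈ nbrIdx i, (t i j * ((x₀ : ℂ) - (ℓ j : ℂ))) * wc j =
        ∑ j ∈ nbrIdx i, ((amat i j : ℝ) : ℂ) * wc j :=
      Finset.sum_congr rfl fun j _ => by rw [htx]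
    rw [← hs]
    exact hcoordw i
  let cf : Fam := fun k => if hk : k = 0 then 0 else
    ∑ a : Fin (odim (toOrbit k hk)), wc ⟨toOrbit k hk, a⟩ • bfam ⟨toOrbit k hk, a⟩ k
  have hcf0 : cf 0 = 0 := by simp [cf]
  have hcf : ∀ O : Orbit, ∀ k ∈ O.1, cf k = ∑ a : Fin (odim O), wc ⟨O, a⟩ • bfam ⟨O, a⟩ k := by
    intro O k hk
    have hk0 : k ≠ 0 := O.ne_zero_of_mem hk
    have hO : toOrbit k hk0 = O := (toOrbit_eq_iff hk0 O).mpr hk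
    subst hO
    simp only [cf, dif_neg hk0]
  have hwsum : ∀ s : ℕ, Summable fun i : Idx => (1 + onormSq i.1) ^ s * ‖wc i‖ ^ 2 := by
    intro s
    refine Summable.of_nonneg_of_le (fun i => mul_nonneg (pow_nonneg (by linarith [onormSq_nonneg i.1]) _)
      (sq_nonneg _)) (fun i => ?_) ((hreg s).mul_left (R ^ s))
    have h1 : 1 + onormSq i.1 ≤ R * Real.sqrt (1 + |ℓ i|) ^ 2 := by
      rw [hwgt, Real.sq_sqrt (by linarith [div_nonneg (onormSq_nonneg i.1) hR0.le]), mul_add, mul_one,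
        mul_div_cancel₀ _ hR0.ne']
      linarith [onormSq_nonneg i.1]
    have h2 : (1 + onormSq i.1) ^ s ≤ (R * Real.sqrt (1 + |ℓ i|) ^ 2) ^ s :=
      pow_le_pow_left₀ (by linarith [onormSq_nonneg i.1]) h1 s
    calc (1 + onormSq i.1) ^ s * ‖wc i‖ ^ 2 ≤ (R * Real.sqrt (1 + |ℓ i|) ^ 2) ^ s * ‖wc i‖ ^ 2 :=
          mul_le_mul_of_nonneg_right h2 (sq_nonneg _)
      _ = R ^ s * (Real.sqrt (1 + |ℓ i|) ^ (2 * s) * ‖⟪b i, w⟫_ℂ‖ ^ 2) := by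
          rw [mul_pow, ← pow_mul]; ring
  have hdecay : RapidDecay cf := rapidDecay_of_coordinates cf wc hcf hcf0 hwsum
  have hct := kdot_of_coordinates cf wc hcf hcf0
  have hne : cf ≠ 0 := by
    have hw0 : w ≠ 0 := by
      intro h; rw [h, norm_zero] at hw1; exact zero_ne_one hw1
    obtain ⟨i, hi⟩ : ∃ i, wc i ≠ 0 := by
      by_contra hall
      push Not at hall
      apply hw0
      apply lp.ext
      funext i
      have := hall i
      rw [hwc] at this
      simp only [hb] at this
      simpa using this
    exact ne_zero_of_coordinates cf wc hcf hi
  have heq := certifier_eigen_of_coordinates (R := R) (lam : ℂ) cf wc hcf hcf0 hcoord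
  refine ⟨lam, hlam, ?_⟩
  have h := AbcLatticeEigenSynthesis.isLinNSEigenvalue_abcFlow_of_certifier_eigen 1 1 1 hR0 (lam : ℂ)
    hdecay hct hcf0 hne (fun k => heq k)
  have e : ((2 * Real.pi * lam : ℝ) : ℂ) = 2 * Real.pi * (lam : ℂ) := by push_cast; ring
  rw [e]
  exact h


end Summit.NavierStokesRegularity.FluidComputer.AbcClassIIOpenBracket

end
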